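import Summits.NavierStokesRegularity.NavierStokesRegularity.Theorems.ClockStretchingLawClockCeilingFarPastClockFloor
import Summits.NavierStokesRegularity.NavierStokesRegularity.Theorems.ClockStretchingLawClockLaw
import Summits.NavierStokesRegularity.NavierStokesRegularity.Theorems.SqueezeCycleSingularZoomExtraction
import Summits.NavierStokesRegularity.NavierStokesRegularity.Theorems.SqueezeCycleExtremalElementExistsRescale
import HarnessLib

/-!
# Route `ClockStretchingLaw`, crux `ClockCeiling` (stmt-NavierStokesRegularity-10570): VELOCITY
# CONCENTRATION FORCES UNSTEADINESS — a uniform structural law of the Type-I ancient class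

Line `registered` of the crux, lead c6, `--supports` file, stub `stub_velocityForcesUnsteadiness`.

The crux reads the clock amplitude `a_u(t; x₀) = (−t)^{3/2} ∫ ‖∂ₜu(t,x)‖² e^{−‖x − x₀‖²/(4(−t))} dx`
of the elements of the Type-I ancient class `A_C` (`IsTypeIAncientMild C u`: smooth,
divergence-free, KNSS-mild ancient fields on `ℝ³ × (−∞,0)` with `‖u(t,x)‖ ≤ C/√(−t)`), recentred at
`x₀`. This file lands a UNIFORM law of the class in that currency, valid for ALL elements at ALL
times (no "nonzero"/"singular" hypothesis):

* `stub_velocityForcesUnsteadiness` — **for every `C` and every `θ > 0` there is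
  `δ = δ(C, θ) > 0` such that for every `u ∈ A_C`, every `t < 0` and every `x₀` with
  `√(−t)‖u(t,x₀)‖ ≥ θ`, the clock recentred at `x₀` reads
  `(−t)^{3/2} ∫ ‖∂ₜu(t,x)‖² e^{−‖x − x₀‖²/(4(−t))} dx ≥ δ`.**

So a Type-I ancient element is never locally quasi-steady, at its own parabolic scale, where it is
large; it subsumes the far-past recentred clock floor `stub_farPastClockFloor`.

Proof: if not, there are `u_k ∈ A_C`, `t_k < 0`, `x_k` with `√(−t_k)‖u_k(t_k,x_k)‖ ≥ θ` and clock
at `t_k` centred at `x_k` below `1/(k+1)`. The zoom recentred at `(0, x_k)` with scale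
`c_k = √(−t_k)`, `v_k(s,y) = c_k u_k(c_k² s, x_k + c_k y)`, stays in `A_C`
(`isTypeIAncientMild_zoom`), has `‖v_k(−1, 0)‖ = √(−t_k)‖u_k(t_k, x_k)‖ ≥ θ` and clock at `s = −1`
centred at the origin equal to the clock of `u_k` at `t_k` centred at `x_k` (`farPastClock_zoom`),
hence `< 1/(k+1)`. KNSS compactness of the class on growing windows
(`exists_tendsto_of_typeI_seq_Ioo`) extracts a pointwise limit `W ∈ A_C`; the amplitudes converge
(`stub_clockSlice` (iii)), so the clock of `W` at `−1` vanishes, `∂ₜW(−1, ·) ≡ 0`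
(`stub_clockSlice` (ii)), and ONE steady slice kills a Type-I KNSS-mild field
(`SteadySliceLiouville`, `clockLaw_eq_zero_of_steady_slice`): `W ≡ 0` — contradicting
`‖W(−1, 0)‖ ≥ θ > 0`.

## References

* G. Koch, N. Nadirashvili, G. Seregin, V. Šverák, Acta Math. 203 (2009) = arXiv:0709.3599, §1 (1.2),
  Lemma 6.1, Prop. 4.1, §6. [KochNadirashviliSereginSverak2009]
* H. Dong, Q. S. Zhang, J. Funct. Anal. 279 (2020) 108563 = arXiv:1907.01687, Thm. 2 (time
  analyticity behind `SteadySliceLiouville`). [DongZhang2020]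
-/

noncomputable section

open MeasureTheory Filter Topology Set Metric Function
open scoped NNReal ENNReal

-- `Summit = Problem` namespace duplication is the tree's layout (CONVENTIONS §1); as in every Theorems file.
set_option linter.dupNamespace false

namespace Summit.NavierStokesRegularity.NavierStokesRegularity.Theorems

open Literature.Analysis Literature.Analysis.FluidPDE
open Summit.NavierStokesRegularity.NavierStokesRegularity.Theorems.ClockLaw.Birth

/-! ### Velocity concentration forces unsteadiness -/

/-- **Stub `stub_velocityForcesUnsteadiness` (structural clause of crux `ClockCeiling`, line
`registered`): VELOCITY CONCENTRATION FORCES UNSTEADINESS.** For every `C` and every `θ > 0` there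
is `δ = δ(C, θ) > 0` such that for every element `u` of the Type-I ancient class `A_C`, every
`t < 0` and every centre `x₀` at which `√(−t)‖u(t,x₀)‖ ≥ θ`, the clock recentred at `x₀` reads
`(−t)^{3/2} ∫ ‖∂ₜu(t,x)‖² e^{−‖x − x₀‖²/(4(−t))} dx ≥ δ` — a Type-I ancient element is never locally
quasi-steady at its own scale where it is large. (Contradiction: recentred zooms at the
concentration points, class invariance `isTypeIAncientMild_zoom` and clock covariance
`farPastClock_zoom`, KNSS compactness `exists_tendsto_of_typeI_seq_Ioo`, convergence of amplitudes
and "a zero of the clock is a steady instant" `stub_clockSlice`, and the proved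
`SteadySliceLiouville` through `clockLaw_eq_zero_of_steady_slice`.)
[cite: KochNadirashviliSereginSverak2009, §1 (1.2), Lemma 6.1 and Prop. 4.1 (arXiv:0709.3599 pp. 2, 8, 11)] -/
theorem stub_velocityForcesUnsteadiness : ∀ (C θ : ℝ), 0 < θ → ∃ δ > 0, ∀ u : ℝ → EuclideanSpace ℝ (Fin 3) → EuclideanSpace ℝ (Fin 3), Literature.Analysis.FluidPDE.IsTypeIAncientMild C u → ∀ t < 0, ∀ x₀ : EuclideanSpace ℝ (Fin 3), θ ≤ Real.sqrt (-t) * ‖u t x₀‖ → δ ≤ (-t) ^ ((3 : ℝ) / 2) * ∫ x, ‖Literature.Analysis.FluidPDE.timeDeriv u t x‖ ^ 2 * Real.exp (-(‖x - x₀‖ ^ 2) / (4 * (-t))) := by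
  intro C θ hθ
  by_contra h
  push Not at h
  -- elements, instants and centres with large scaled velocity but recentred clock `< 1/(n+1)`
  have hseq : ∀ n : ℕ, ∃ u : ℝ → EuclideanSpace ℝ (Fin 3) → EuclideanSpace ℝ (Fin 3),
      IsTypeIAncientMild C u ∧ ∃ t < 0, ∃ x₀ : EuclideanSpace ℝ (Fin 3),
        θ ≤ Real.sqrt (-t) * ‖u t x₀‖ ∧ (-t) ^ ((3 : ℝ) / 2) *
          ∫ x, ‖timeDeriv u t x‖ ^ 2 * Real.exp (-(‖x - x₀‖ ^ 2) / (4 * (-t))) <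
            1 / ((n : ℝ) + 1) := fun n => by
    obtain ⟨u, hu, t, ht, x₀, hθ', hlt⟩ := h _ Nat.one_div_pos_of_nat
    exact ⟨u, hu, t, ht, x₀, hθ', hlt⟩
  choose u hu τ hτ0 ξ hξ hlt using hseq
  -- the scales `c n = √(-τ n)` and the recentred zooms `v n`
  obtain ⟨c, hc_def⟩ : ∃ c : ℕ → ℝ, ∀ n, c n = Real.sqrt (-(τ n)) := ⟨_, fun n => rfl⟩
  have hcpos : ∀ n, 0 < c n := fun n => by rw [hc_def]; exact Real.sqrt_pos.2 (neg_pos.2 (hτ0 n))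
  have hcsq : ∀ n, c n ^ 2 = -(τ n) := fun n => by
    rw [hc_def]; exact Real.sq_sqrt (neg_nonneg.2 (hτ0 n).le)
  obtain ⟨v, hv_def⟩ : ∃ v : ℕ → ℝ → EuclideanSpace ℝ (Fin 3) → EuclideanSpace ℝ (Fin 3),
      ∀ n, v n = c n • stPull (c n ^ 2) (c n) 0 (ξ n) (u n) := ⟨_, fun n => rfl⟩
  have hv : ∀ n, IsTypeIAncientMild C (v n) := fun n => by
    rw [hv_def]; exact isTypeIAncientMild_zoom (hu n) (hcpos n) (ξ n)
  -- the unit-scale values `v n (-1) 0` stay above `θ`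
  have hval : ∀ n, θ ≤ ‖v n (-1) 0‖ := by
    intro n
    have e : v n (-1) 0 = c n • u n (τ n) (ξ n) := by
      rw [hv_def, zoom_apply, smul_zero, add_zero, mul_neg_one, hcsq, neg_neg]
    rw [e, norm_smul, Real.norm_of_nonneg (hcpos n).le, hc_def]
    exact hξ n
  -- the clocks of `v n` at `-1` centred at the origin dip below `1/(n+1)`
  have hclock : ∀ n, (-(-1 : ℝ)) ^ ((3 : ℝ) / 2) *
      ∫ y, ‖timeDeriv (v n) (-1) y‖ ^ 2 * Real.exp (-(‖y‖ ^ 2) / (4 * (-(-1 : ℝ)))) <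
        1 / ((n : ℝ) + 1) := by
    intro n
    rw [hv_def, farPastClock_zoom (u n) (hcpos n) (ξ n) (by norm_num : (-1 : ℝ) < 0)]
    have e2 : c n ^ 2 * (-1 : ℝ) = τ n := by rw [hcsq]; ring
    rw [e2]
    exact hlt n
  -- compactness of the class on the growing windows `(-(k+1), 0)`
  set A : ℕ → ℝ := fun k => -((k : ℝ) + 1) with hA
  have hAt : Tendsto A atTop atBot :=
    tendsto_neg_atTop_atBot.comp (tendsto_natCast_atTop_atTop.atTop_add tendsto_const_nhds)
  have hcont : ∀ k, ContinuousOn (uncurry (v k)) (Ioo (A k) 0 ×ˢ univ) := fun k =>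
    (hv k).continuousOn_uncurry.mono (prod_mono (fun t ht => ht.2) subset_rfl)
  have hdivw : ∀ k, ∀ t ∈ Ioo (A k) 0, IsWeaklyDivFree (v k t) := fun k t ht =>
    (hv k).isWeaklyDivFree ht.2
  have hmild : ∀ k, ∀ s t : ℝ, A k < s → s < t → t < 0 → ∀ x,
      v k t x = UnboundedOperators.heatExtension (v k s) (t - s) x -
        oseenDuhamel 1 s (v k) (v k) t x :=
    fun k s t _ hst ht x => (hv k).mild_eq_heatExtension hst ht x
  have hI : ∀ k, ∀ t ∈ Ioo (A k) 0, ∀ x, ‖v k t x‖ ≤ C / Real.sqrt (-t) := fun k t ht x =>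
    (hv k).norm_le ht.2 x
  obtain ⟨φ, hφ, W, hW, hpt, -, -, -⟩ :=
    exists_tendsto_of_typeI_seq_Ioo C hAt hcont hdivw hmild hI
  -- the clocks at `-1` converge, to a limit `≤ 0`, hence `= 0`: a steady slice of `W`
  obtain ⟨-, hsteady0, hconv, -⟩ := stub_clockSlice stub_timeDerivBounds
  have hlimA := hconv C (fun j => v (φ j)) W (fun j => hv (φ j)) hW hpt (-1) (by norm_num)
  have hb : Tendsto (fun j : ℕ => 1 / ((φ j : ℝ) + 1)) atTop (𝓝 0) :=
    (tendsto_one_div_add_atTop_nhds_zero_nat (𝕜 := ℝ)).comp hφ.tendsto_atTop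
  have hle : (-(-1 : ℝ)) ^ ((3 : ℝ) / 2) *
      ∫ y, ‖timeDeriv W (-1) y‖ ^ 2 * Real.exp (-(‖y‖ ^ 2) / (4 * (-(-1 : ℝ)))) ≤ 0 :=
    le_of_tendsto_of_tendsto' hlimA hb fun j => (hclock (φ j)).le
  have hzeroA : (-(-1 : ℝ)) ^ ((3 : ℝ) / 2) *
      ∫ y, ‖timeDeriv W (-1) y‖ ^ 2 * Real.exp (-(‖y‖ ^ 2) / (4 * (-(-1 : ℝ)))) = 0 :=
    le_antisymm hle (clockLaw_amp_nonneg W (by norm_num))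
  have hsteady : ∀ y, timeDeriv W (-1) y = 0 := hsteady0 C W hW (-1) (by norm_num) hzeroA
  -- one steady slice kills a Type-I KNSS-mild field (`SteadySliceLiouville`)
  have hWzero := clockLaw_eq_zero_of_steady_slice hW (by norm_num : (-1 : ℝ) < 0) hsteady
  -- but the unit-scale values persist in the limit
  have hlimv : Tendsto (fun j => ‖v (φ j) (-1) 0‖) atTop (𝓝 ‖W (-1) 0‖) :=
    (hpt (-1) (by norm_num) 0).norm
  have hge : θ ≤ ‖W (-1) 0‖ := ge_of_tendsto' hlimv fun j => hval (φ j)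
  rw [hWzero (-1) (by norm_num) 0, norm_zero] at hge
  exact absurd hge (not_le.2 hθ)

end Summit.NavierStokesRegularity.NavierStokesRegularity.Theorems

end
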